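import Summits.QuantumFields.BalabanUV.T4Continuum.Support.OutputRateComplexSliceEntrywise
import Summits.QuantumFields.BalabanUV.T4Continuum.Support.OutputRateComplexSliceWitness

/-!
# OutputRateDrivingSlices — THE W1 SOCKET OF ROAD D ALONG COORDINATE SLICES WITH TWO ANALYTIC LETTERS (Q-NE23-W″; rulings R57∕R58):
# (§1) no two-level rate on a FREE tower window — the real window of the slice road must be `LocalRate`-constrained (of record, R58: the
# AVERAGING towers of regular fine fields; alternative: driven towers); (§2–§4) the per-entry slice letters of `OutputRateComplexSliceEntrywise`
# PRODUCED from species-in-chart holomorphy and a coordinate slice carrying two analytic letters (of record, R58: a FINE-FIELD slice — complex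
# block-averaging holomorphy; alternative: a driven slice — minimiser holomorphy); (§5–§6) bookkeeping for the driven ALTERNATIVE (NE5 on a
# sub-carrier; node U3 on the driven pair; the two transports one triangle inequality apart) — true statements with no role of record after R58

v1.1 = DOCFIX of v1 (p238560, commit ca2b2112b821): every declaration and proof byte-identical; the docstrings that called the DRIVEN road
«forced» (ruling R57 (1)(3)(4)(6), `HOME/CLAIMS.log` l.22107) are re-worded after the same-hour correction R58 (l.22206).

Cell `pub-balaban`, unit `b2b-balaban-t4-ne5-p1` (row NE5 OWNER, gen 38; owner item «g38-a», `HOME/CLAIMS.log` l.21813 ∕ l.22107 ∕ l.22206).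
Summits-side NEW WORK under the LEAN PLACEMENT RULE ([folklore] bookkeeping over ABSTRACT charts + one toy witness; nothing printed is asserted;
no citation tags; no `Prop`-valued fact minted; 0 `def`).  HONEST FRAMING: rung (B)+1 of the FINITE-VOLUME T⁴ continuum programme — NOT infinite
volume, NOT a mass gap, NOT the Clay problem, NOT a proof of NE5 (NOT PRINTED; GAPS G-t4-U3-1), NOT a proof of NE2 or NE3.  HONEST DEPENDENCY
(cell, verbatim): continuum YM on T⁴ ⇐ BetaPertH ∧ nine spine estimates (0/9 proved); BetaPertH ⇐ (D1) ∧ (D4) ∧ CAP+tail; G-an2-4 gates asym,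
D1 and NE2/3/4.

WHY.  On Road D of record (R49∕R51∕R52) the W1 binder of `B13StepEndInsOp.ne5_of_record_insOp` is consumed at COMPLEX points of the
recursion chart and is produced there (`OutputRateComplexSliceEntrywise.weightedEntrywiseRate_complex_of_record`, p230570) from (i) the W1
binder of record on a REAL background type `BgR` read into the slice chart `𝒱` through `ρ : BgR → 𝒱`, and (ii) per-entry slice letters:
through every chart point a complex one-parameter slice `γ` of relative depth `≤ r` whose REAL FEET lie in `Set.range ρ`, along which each
entry of both runs' families is holomorphic and obeys the one-run format bound.  The design point Q-NE23-W′∕W″ (owner NOTE l.19989;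
substrate-p1 l.20179; substrate-typer (ν3)(A) l.20219) was: on WHICH real window can (i) be supplied — W-20's `realWindow` of FREE unitary
towers near the centres (slices in free tower coordinates), or a `LocalRate`-constrained window?  This module records the NE5-side answer:
* §1 (`freeWindow_no_rate` vs `twoLevelRate_of_depthRate_localRate`): a species that reads the level-`k` coefficient of its background
  tower (Lipschitz, with a same-background two-depth rate — row NE2's mechanism: [Balaban1984PropagatorsI] (1.83) ∕ [King1986] (4.18)
  KIND at a fixed background + Lipschitz × `LocalRate`) HAS the two-level rate `a·θ₀^k + Λ·C·θ^k` on every tower whose consecutive levels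
  are `C·θ^k`-consistent, and has NO uniform rate on the free window `{T | ∀ j, |T j| ≤ 1}` (the tower `𝟙_{k+1}`): the rate is a property
  of the WINDOW, not of the species — a free-TOWER `real` is REFUSED as a W1 socket (R57 (2); as independent pair coordinates were in
  `OutputRateComplexSliceLetters.independentPairs_no_rate`, R52 (2)).  OF RECORD (R58): the `LocalRate`-constrained window print uses is
  the window of AVERAGING TOWERS of free REGULAR FINE FIELDS ([Balaban1988RG2Cluster] p. 7: the inserted terms are analytic on
  `U^c_{k+1}(Y, (1+2β)α₀, (1+2β)α₁)` — free complex fine configurations; the species read the averaging tower `towerDataOf … U`, run A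
  through `resA`), whose two-level consistency is REGULARITY — row NE2's kernel bridge `NE2FromNE3BavgBridge.localRate_regClass_of_bavg_consistent`
  — and NOT a minimiser statement: node NE3 does not enter NE5 (it stays in node U3's argument bracket, `T4OutputRate.u3_threeBrackets`).
* §2–§4 (`diffContOnCl_comp_of_mapsTo`, `hslice_of_drivingSlices`, `weightedEntrywiseRate_complex_of_drivingSlices`): the per-entry
  slice letters of p230570 are PRODUCED from three letters an instance can name one by one — (L1) SPECIES-IN-CHART: each entry of each
  run's family, composed with a chart `χ b : Coord → 𝒱` centred at a real datum `b`, is ℂ-differentiable on a coordinate ball `‖c‖ < ϱ k b`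
  and obeys the one-run format bound there (printed KIND: [Balaban1988RG2Cluster] (1.5) p. 3, p. 6; [Balaban1985BackgroundPropagators]
  Thm 3.4; the substrate PROVED such letters for the covariance species on an explicit ball —
  `SubstrateTransporterSpeciesLevExplicit.analyticOnNhd_covAtTLev_printed_on_ballExplicit`, `SubstrateProbesChartLevExplicit`); (L2) a
  COORDINATE SLICE `a : ℂ → Coord` through the chart point with `DiffContOnCl ℂ a (ball 0 1)` and `MapsTo a (closedBall 0 1) (ball 0 (ϱ k b))`
  — OF RECORD (R58) `a` is the tower-chart coordinate of the COMPLEXIFIED AVERAGING TOWER along a fine-field slice `z ↦ U₀·exp(z·H)`, so that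
  (L2) is the COMPLEX BLOCK-AVERAGING holomorphy + depth-control letter ([Balaban1985Averaging] ∕ [Balaban1987RG1] (0.4)–(0.7) KIND: algebraic;
  asserted by nobody; substrate item W-22 re-scoped `SubstrateFineFieldChart`); on the driven ALTERNATIVE (ii) `a` would be the coordinate of
  run B's tower of record along a driving slice and (L2) the minimiser-holomorphy letter ([Balaban1987RG1] §1 + Lemma 4 p. 280,
  [Balaban1985Variational] Thm 1 KIND) — NOT of record; (L3) the foot identities: `χ b (a z₀) = emb u`, `‖z₀‖ ≤ r`, and real feet
  `χ b (a x) ∈ Set.range ρ` for real `|x| < 1` — true BY CONSTRUCTION when `a x` is the coordinate of the averaging tower `ρ b'` of a real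
  regular fine field (the slice moves the fine field, not the tower levels independently; so `OutputRateComplexSliceWitness.basePoint_no_rate`'s
  objection to `real := Set.range ρ` — G-ne5p1-R52 (3) — is met).  The composition is Mathlib's chain rule (`DifferentiableOn.comp`,
  `ContinuousOn.comp`); the theorems are ROAD-AGNOSTIC (any `Ctr`, `Coord`, `ϱ`, `a`; the name «driving» is historical): the substrate supplies
  (L1)(L2)(L3), row NE2 supplies `hwer` on averaging towers of regular fields (`B13ReadingsDecay.balaban_twoLevelDecayRate_rate`, whose
  `LocalRate` binder the bridge discharges from regularity) — no free-tower rate and no minimiser input is asked of anybody.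
* §5 (`u3_threeBrackets_at` ∕ `_on`, `ne5_iff_on_univ`): node U3's three-bracket bound at a run-B background `UB` uses NE5 AT `UB` ONLY, so
  NE5 on any set `S ∋ UB` serves node U3 at `UB` (bookkeeping; under R58 NE5's run-B carrier stays the regular fine fields as typed, so
  `S = univ` and nothing is restricted).
* §6 (`drivenPair_twoBrackets`, `ne5At_transport_of_drivenPairRate`): bookkeeping for the driven ALTERNATIVE (ii): at the driven pair
  `(uA v, uB v)` node U3 needs only NE9 + the pair rate, and `T4OutputRate.NE5`'s inequality at `transport (uB v)` follows from the pair rate by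
  ONE triangle inequality with `LipBackground` × `BackgroundsClose`.  (v1's claim that MI-R is print-faithful «only» on the driven pair was
  WRONG and is withdrawn by R58: on the averaging-tower road MI-R for run A is faithful with `ℰA := EA ∘ transport`, the block-averaging
  transport being a submersion — an (M4) detail of the run-A insertion datum.)
WHAT IS NOT HERE.  No instance (the chart `χ`, the radius `ϱ`, the slices `a`, the real type `BgR` and `ρ` are the substrate's W-20 ∕
W-22 objects); no estimate of [II]; `hwer` on `BgR` is row NE2's (W-21b displays it, packaged with `NE3Shape` — to be re-pointed to the
`LocalRate`-of-the-averaging-tower binder, Q-S22).  0 sorry; axioms ⊆ {propext, Classical.choice, Quot.sound}.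
-/

noncomputable section

open Complex Set Metric Real
open scoped BigOperators

namespace Summit.QuantumFields.BalabanUV.T4Continuum.OutputRateDrivingSlices

open Summit.QuantumFields.BalabanUV.T4Continuum.B13OpDatum
open Summit.QuantumFields.BalabanUV.T4Continuum.B13OpDatumJunctions
open Summit.QuantumFields.BalabanUV.T4Continuum.OutputRateComplexSliceEntrywise
open Summit.QuantumFields.BalabanUV.T4Continuum.OutputRateComplexSliceWitness (no_rate_of_floor)
open Literature.MathematicalPhysics.QuantumFieldTheory.Balaban1983to89.T4OutputRate

/-! ## §1 The rate is the window's: two-level consistent towers (averaging towers of regular fields, R58; or driven towers) YES, free towers NO -/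

/-- [folklore] **TWO-LEVEL RATE ON A TWO-LEVEL CONSISTENT TOWER** (row NE2's mechanism in one line, scalar toy currency): a level-indexed species
`f k` that is `Λ`-Lipschitz in the level-`k` coefficient of its background tower and has the same-background two-depth rate
`|f k x − f (k+1) x| ≤ a·θ₀^k` ([Balaban1984PropagatorsI] (1.83) ∕ [King1986] (4.18) KIND — a letter here) satisfies, on every tower `T`
whose consecutive levels are `C·θ^k`-consistent (row NE2's `LocalRate` binder — for averaging towers a consequence of regularity, R58), the two-level rate
`|f k (T k) − f (k+1) (T (k+1))| ≤ a·θ₀^k + Λ·C·θ^k`. -/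
theorem twoLevelRate_of_depthRate_localRate {f : ℕ → ℝ → ℝ} {Λ a θ₀ C θ : ℝ} (hΛ : 0 ≤ Λ)
    (hLip : ∀ k x y, |f k x - f k y| ≤ Λ * |x - y|) (hdepth : ∀ k x, |f k x - f (k + 1) x| ≤ a * θ₀ ^ k)
    (T : ℕ → ℝ) (hT : ∀ j, |T (j + 1) - T j| ≤ C * θ ^ j) (k : ℕ) :
    |f k (T k) - f (k + 1) (T (k + 1))| ≤ a * θ₀ ^ k + Λ * C * θ ^ k := by
  have h1 := hdepth k (T k)
  have h2 : |f (k + 1) (T k) - f (k + 1) (T (k + 1))| ≤ Λ * C * θ ^ k := by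
    refine (hLip (k + 1) (T k) (T (k + 1))).trans ?_
    rw [abs_sub_comm, mul_assoc]
    exact mul_le_mul_of_nonneg_left (hT k) hΛ
  calc |f k (T k) - f (k + 1) (T (k + 1))|
      ≤ |f k (T k) - f (k + 1) (T k)| + |f (k + 1) (T k) - f (k + 1) (T (k + 1))| := abs_sub_le _ _ _
    _ ≤ a * θ₀ ^ k + Λ * C * θ ^ k := add_le_add h1 h2

/-- [folklore] **NO TWO-LEVEL RATE ON A FREE TOWER WINDOW.**  For the species that reads the level coefficient itself (`f k x = x`:
`Λ = 1`, two-depth rate `a = 0` — the best case of `twoLevelRate_of_depthRate_localRate`) there are NO `δ`, `θ < 1` with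
`|T k − T (k+1)| ≤ δ·θ^k` for all `k` and all towers of the FREE window `{T | ∀ j, |T j| ≤ 1}`: the tower `𝟙_{k+1}` has discrepancy `1` at
step `k`.  The two-level rate consumed by W1 is a property of a `LocalRate`-CONSTRAINED window (averaging towers of regular fields, R58; or
driven towers), not of the species — a free-tower real window cannot be a W1 socket. -/
theorem freeWindow_no_rate :
    ¬ ∃ δ θ : ℝ, θ < 1 ∧ ∀ (k : ℕ) (T : ℕ → ℝ), (∀ j, |T j| ≤ 1) → |T k - T (k + 1)| ≤ δ * θ ^ k := by
  rintro ⟨δ, θ, hθ, h⟩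
  refine no_rate_of_floor (y := fun _ : ℕ => (1 : ℝ)) (m := 1) one_pos (fun _ => le_rfl) ⟨δ, θ, hθ, fun k => ?_⟩
  have h1 : |(if k = k + 1 then (1 : ℝ) else 0) - (if k + 1 = k + 1 then (1 : ℝ) else 0)| ≤ δ * θ ^ k :=
    h k (fun j => if j = k + 1 then (1 : ℝ) else 0) fun j => by
      by_cases hj : j = k + 1
      · rw [if_pos hj]; simp
      · rw [if_neg hj]; simp
  rw [if_neg (show ¬ (k = k + 1) by omega), if_pos rfl] at h1
  norm_num at h1
  exact h1

/-- [folklore] **… while on the LocalRate-constrained window the same species has the rate at once** (`C·θ^k`, the window's letter). -/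
theorem localRateWindow_rate {C θ : ℝ} (T : ℕ → ℝ) (hT : ∀ j, |T (j + 1) - T j| ≤ C * θ ^ j) (k : ℕ) :
    |T k - T (k + 1)| ≤ C * θ ^ k := by
  rw [abs_sub_comm]; exact hT k

/-! ## §2 Holomorphy and bounds along a composed slice: species-in-chart ∘ coordinate slice -/

variable {Coord : Type*} [NormedAddCommGroup Coord] [NormedSpace ℂ Coord]
variable {Op' : Type*} [NormedAddCommGroup Op'] [NormedSpace ℂ Op']

/-- [folklore] **THE SLICE CLAUSE BY COMPOSITION.**  If a species in chart coordinates `F : Coord → Op'` is ℂ-differentiable on the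
coordinate ball `‖c‖ < ϱ` (letter (L1)) and the coordinate slice `a : ℂ → Coord` is holomorphic in the open unit disc, continuous on the
closed disc and maps the CLOSED disc into that ball (letter (L2): of record the complex block-averaging holomorphy + depth control of a
fine-field slice, R58; on the driven alternative, minimiser holomorphy), then `z ↦ F (a z)` is `DiffContOnCl` on the unit disc — the
holomorphy clause of the slice letters.  Mathlib's chain rule. -/
theorem diffContOnCl_comp_of_mapsTo {F : Coord → Op'} {a : ℂ → Coord} {ϱ : ℝ} (hF : DifferentiableOn ℂ F (ball 0 ϱ))
    (ha : DiffContOnCl ℂ a (ball 0 1)) (hmaps : MapsTo a (closedBall 0 1) (ball 0 ϱ)) :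
    DiffContOnCl ℂ (fun z => F (a z)) (ball 0 1) :=
  DiffContOnCl.mk_ball (hF.comp ha.differentiableOn (hmaps.mono_left ball_subset_closedBall))
    (hF.continuousOn.comp ha.continuousOn_ball hmaps)

omit [NormedSpace ℂ Coord] [NormedSpace ℂ Op'] in
/-- [folklore] **The bound clause by composition**: a bound of `F` on the coordinate ball transports to the closed unit disc along `a`. -/
theorem norm_comp_le_of_mapsTo {F : Coord → Op'} {a : ℂ → Coord} {ϱ M : ℝ} (hbd : ∀ c ∈ ball (0 : Coord) ϱ, ‖F c‖ ≤ M)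
    (hmaps : MapsTo a (closedBall 0 1) (ball 0 ϱ)) : ∀ z : ℂ, ‖z‖ ≤ 1 → ‖F (a z)‖ ≤ M :=
  fun z hz => hbd (a z) (hmaps (mem_closedBall_zero_iff.mpr hz))

/-! ## §3 The per-entry slice letters of record PRODUCED from coordinate-slice data (road-agnostic; «driving» is the historical name) -/

variable {E : Type*} {𝒰 𝒱 Ctr BgR : Type}

/-- [folklore] **`hslice` OF `OutputRateComplexSliceEntrywise` FROM COORDINATE SLICES WITH TWO ANALYTIC LETTERS** (of record, R58: fine-field
slices through complexified averaging towers; the statement is road-agnostic).  Entry families `KA KB : (ℕ → ℝ) → ℕ → 𝒱 → E → ℂ`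
on the slice chart `𝒱`, formats `F`, the recursion chart read through `emb : 𝒰 → 𝒱`, real data read through `ρ : BgR → 𝒱`, charts
`χ : Ctr → Coord → 𝒱` centred at real data with radius letters `ϱ : ℕ → Ctr → ℝ`.  Suppose (L1) for every level, window coupling, centre
`b` and entry `e`, both `c ↦ KA g k (χ b c) e` and `c ↦ KB g k (χ b c) e` are ℂ-differentiable on `ball 0 (ϱ k b)` and obey the one-run
format bound `≤ B·wt e` there; and (L2)+(L3) through every `(k, g, u, e)` there is a centre `b`, a coordinate slice `a` and a parameter `z₀`
with `‖z₀‖ ≤ r`, `χ b (a z₀) = emb u`, real feet `χ b (a x) ∈ Set.range ρ` (`|x| < 1`), `DiffContOnCl ℂ a (ball 0 1)` and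
`MapsTo a (closedBall 0 1) (ball 0 (ϱ k b))`.  Then the per-entry slice letters of `weightedEntrywiseRate_complex_of_record` hold with
`γ := χ b ∘ a`. -/
theorem hslice_of_drivingSlices (F : ℕ → Format E) {KA KB : (ℕ → ℝ) → ℕ → 𝒱 → E → ℂ} (ρ : BgR → 𝒱) (emb : 𝒰 → 𝒱)
    (χ : Ctr → Coord → 𝒱) {ϱ : ℕ → Ctr → ℝ} {W : Set (ℕ → ℝ)} {B r : ℝ}
    (hKA : ∀ k, ∀ g ∈ W, ∀ (b : Ctr) (e : E), DifferentiableOn ℂ (fun c => KA g k (χ b c) e) (ball 0 (ϱ k b)) ∧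
      ∀ c ∈ ball (0 : Coord) (ϱ k b), ‖KA g k (χ b c) e‖ ≤ B * (F k).wt e)
    (hKB : ∀ k, ∀ g ∈ W, ∀ (b : Ctr) (e : E), DifferentiableOn ℂ (fun c => KB g k (χ b c) e) (ball 0 (ϱ k b)) ∧
      ∀ c ∈ ball (0 : Coord) (ϱ k b), ‖KB g k (χ b c) e‖ ≤ B * (F k).wt e)
    (hdrv : ∀ k, ∀ g ∈ W, ∀ (u : 𝒰) (e : E), ∃ (b : Ctr) (a : ℂ → Coord) (z₀ : ℂ), ‖z₀‖ ≤ r ∧ χ b (a z₀) = emb u ∧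
      (∀ x : ℝ, |x| < 1 → χ b (a x) ∈ Set.range ρ) ∧ DiffContOnCl ℂ a (ball 0 1) ∧ MapsTo a (closedBall 0 1) (ball 0 (ϱ k b))) :
    ∀ k, ∀ g ∈ W, ∀ (u : 𝒰) (e : E), ∃ γ : ℂ → 𝒱, ∃ z₀ : ℂ, ‖z₀‖ ≤ r ∧ γ z₀ = emb u ∧
      (∀ x : ℝ, |x| < 1 → γ x ∈ Set.range ρ) ∧
      DiffContOnCl ℂ (fun z => KA g k (γ z) e) (ball 0 1) ∧ DiffContOnCl ℂ (fun z => KB g k (γ z) e) (ball 0 1) ∧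
        (∀ z : ℂ, ‖z‖ ≤ 1 → ‖KA g k (γ z) e‖ ≤ B * (F k).wt e) ∧ ∀ z : ℂ, ‖z‖ ≤ 1 → ‖KB g k (γ z) e‖ ≤ B * (F k).wt e := by
  intro k g hg u e
  obtain ⟨b, a, z₀, hz₀, hau, hfeet, ha, hmaps⟩ := hdrv k g hg u e
  obtain ⟨hdA, hbA⟩ := hKA k g hg b e
  obtain ⟨hdB, hbB⟩ := hKB k g hg b e
  exact ⟨fun z => χ b (a z), z₀, hz₀, hau, hfeet, diffContOnCl_comp_of_mapsTo hdA ha hmaps,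
    diffContOnCl_comp_of_mapsTo hdB ha hmaps, norm_comp_le_of_mapsTo hbA hmaps, norm_comp_le_of_mapsTo hbB hmaps⟩

/-! ## §4 END of this module: W1 of record over the recursion chart from `hwer` on the real background type + (L1)(L2)(L3) -/

/-- [folklore] **W1 OVER THE RECURSION CHART FROM THE REAL-WINDOW RATE AND THE SLICE DATA** (= §3 ∘ `weightedEntrywiseRate_complex_of_record`
BY NAME).  From the W1 binder of record on the REAL background type `BgR` (`hwer`, rate `θ^k` — of record (R58): row NE2's two-level rate on
the AVERAGING towers of regular real fine fields, `LocalRate` from regularity; W-21b's face displays it), the readings `hAr`∕`hBr` (real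
backgrounds read at their towers `ρ b`) and `hA`∕`hB` (chart points read through `emb`), the species-in-chart letters (L1) and the slices
(L2)(L3): the W1 binder of record over the recursion chart `𝒰` at the degraded level-free pair `(δ^{1−λ}(2B)^{λ}, θ^{1−λ})`,
`λ = (2∕π)arctan(2r∕(1−r²))`, and `RawBounded` of both runs there. -/
theorem weightedEntrywiseRate_complex_of_drivingSlices (F : ℕ → Format E)
    {rawAr rawBr : (ℕ → ℝ) → BgR → ℕ → E → ℂ} {rawA rawB : (ℕ → ℝ) → 𝒰 → ℕ → E → ℂ}
    {KA KB : (ℕ → ℝ) → ℕ → 𝒱 → E → ℂ} (ρ : BgR → 𝒱) (emb : 𝒰 → 𝒱) (χ : Ctr → Coord → 𝒱) {ϱ : ℕ → Ctr → ℝ}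
    {W : Set (ℕ → ℝ)} {δ θ B r : ℝ} (hδ : 0 ≤ δ) (hδB : δ ≤ 2 * B) (hθ : 0 ≤ θ) (hθ1 : θ ≤ 1) (hr : r < 1)
    (hAr : ∀ g ∈ W, ∀ b k, rawAr g b k = KA g k (ρ b)) (hBr : ∀ g ∈ W, ∀ b k, rawBr g b k = KB g k (ρ b))
    (hA : ∀ g ∈ W, ∀ u k, rawA g u k = KA g k (emb u)) (hB : ∀ g ∈ W, ∀ u k, rawB g u k = KB g k (emb u))
    (hwer : WeightedEntrywiseRate F rawAr rawBr W δ fun k => θ ^ k)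
    (hKA : ∀ k, ∀ g ∈ W, ∀ (b : Ctr) (e : E), DifferentiableOn ℂ (fun c => KA g k (χ b c) e) (ball 0 (ϱ k b)) ∧
      ∀ c ∈ ball (0 : Coord) (ϱ k b), ‖KA g k (χ b c) e‖ ≤ B * (F k).wt e)
    (hKB : ∀ k, ∀ g ∈ W, ∀ (b : Ctr) (e : E), DifferentiableOn ℂ (fun c => KB g k (χ b c) e) (ball 0 (ϱ k b)) ∧
      ∀ c ∈ ball (0 : Coord) (ϱ k b), ‖KB g k (χ b c) e‖ ≤ B * (F k).wt e)
    (hdrv : ∀ k, ∀ g ∈ W, ∀ (u : 𝒰) (e : E), ∃ (b : Ctr) (a : ℂ → Coord) (z₀ : ℂ), ‖z₀‖ ≤ r ∧ χ b (a z₀) = emb u ∧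
      (∀ x : ℝ, |x| < 1 → χ b (a x) ∈ Set.range ρ) ∧ DiffContOnCl ℂ a (ball 0 1) ∧ MapsTo a (closedBall 0 1) (ball 0 (ϱ k b))) :
    WeightedEntrywiseRate F rawA rawB W
      (δ ^ (1 - 2 / π * Real.arctan (2 * r / (1 - r ^ 2))) * (2 * B) ^ (2 / π * Real.arctan (2 * r / (1 - r ^ 2))))
      (fun k => (θ ^ (1 - 2 / π * Real.arctan (2 * r / (1 - r ^ 2)))) ^ k) ∧
      RawBounded F rawA W ∧ RawBounded F rawB W :=
  weightedEntrywiseRate_complex_of_record F ρ emb hδ hδB hθ hθ1 hr hAr hBr hA hB hwer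
    (hslice_of_drivingSlices F ρ emb χ hKA hKB hdrv)

/-! ## §5 Node U3 consumes NE5 one run-B background at a time -/

variable {C : Carriers}

/-- [folklore] **NODE U3's THREE BRACKETS AT ONE BACKGROUND, FROM NE5 AT THAT BACKGROUND** (`T4OutputRate.u3_threeBrackets` with its
NE5 hypothesis weakened to the single run-B background `UB` at which the brackets are evaluated): NE9 + Lipschitz-in-U on run A + the
η-rate of the two functionals AT `UB` + `δ`-closeness of `UA` to `transport UB` ⟹ the three-bracket bound at `(UA, UB)`.  Two triangle
inequalities, as in `u3_threeBrackets`. -/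
theorem u3_threeBrackets_at {W : Set (ℕ → ℝ)} {EA : Functional C C.BgA} {EB : Functional C C.BgB}
    {κ θ C₅ : ℝ} {Λ : ℕ → ℕ → ℝ} {CU : (ℕ → ℝ) → ℕ → ℝ}
    (h9 : NE9 EA W κ Λ) (hU : LipBackground EA W κ CU)
    {gA gB : ℕ → ℝ} (hgA : gA ∈ W) (hgB : gB ∈ W)
    {UA : C.BgA} {UB : C.BgB} {δ : ℝ} (hδ : C.gauge UA (C.transport UB) ≤ δ)
    (X : C.Dom) (hCU : 0 ≤ CU gA (C.scale X))
    (h5at : |EA gB (C.transport UB) X - EB gB UB X| ≤ C₅ * θ ^ C.scale X * Real.exp (-(κ * C.d X))) :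
    |EA gA UA X - EB gB UB X| ≤
      (CU gA (C.scale X) * δ
        + (∑ i ∈ Finset.range (C.scale X), Λ (C.scale X) i * |gA i - gB i|)
        + C₅ * θ ^ C.scale X) * Real.exp (-(κ * C.d X)) := by
  have he : 0 < Real.exp (-(κ * C.d X)) := Real.exp_pos _
  have h1 : |EA gA UA X - EA gA (C.transport UB) X| ≤
      CU gA (C.scale X) * Real.exp (-(κ * C.d X)) * C.gauge UA (C.transport UB) :=
    hU gA hgA UA (C.transport UB) X
  have h1' : CU gA (C.scale X) * Real.exp (-(κ * C.d X)) * C.gauge UA (C.transport UB) ≤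
      CU gA (C.scale X) * Real.exp (-(κ * C.d X)) * δ :=
    mul_le_mul_of_nonneg_left hδ (mul_nonneg hCU he.le)
  have h2 : |EA gA (C.transport UB) X - EA gB (C.transport UB) X| ≤
      Real.exp (-(κ * C.d X)) * ∑ i ∈ Finset.range (C.scale X), Λ (C.scale X) i * |gA i - gB i| :=
    h9 gA hgA gB hgB (C.transport UB) X
  have t1 := abs_sub_le (EA gA UA X) (EA gA (C.transport UB) X) (EB gB UB X)
  have t2 := abs_sub_le (EA gA (C.transport UB) X) (EA gB (C.transport UB) X) (EB gB UB X)
  have eq : (CU gA (C.scale X) * δ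
        + (∑ i ∈ Finset.range (C.scale X), Λ (C.scale X) i * |gA i - gB i|)
        + C₅ * θ ^ C.scale X) * Real.exp (-(κ * C.d X))
      = CU gA (C.scale X) * Real.exp (-(κ * C.d X)) * δ
        + Real.exp (-(κ * C.d X)) * (∑ i ∈ Finset.range (C.scale X), Λ (C.scale X) i * |gA i - gB i|)
        + C₅ * θ ^ C.scale X * Real.exp (-(κ * C.d X)) := by ring
  rw [eq]
  linarith

/-- [folklore] **NE5 ON A SET OF RUN-B BACKGROUNDS SERVES NODE U3 ON THAT SET.**  If the η-rate inequality of `T4OutputRate.NE5` holds for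
the run-B backgrounds of a set `S` (e.g. the driven image `{U^B_{K+1}(V) | V admissible}` — R57 (3), WITHDRAWN by R58: under the ruling of
record `S = univ`, the regular fine fields as typed), then node U3's three brackets hold at every `UB ∈ S`.  Bookkeeping. -/
theorem u3_threeBrackets_on {W : Set (ℕ → ℝ)} {EA : Functional C C.BgA} {EB : Functional C C.BgB}
    {κ θ C₅ : ℝ} {Λ : ℕ → ℕ → ℝ} {CU : (ℕ → ℝ) → ℕ → ℝ} {S : Set C.BgB}
    (h9 : NE9 EA W κ Λ) (hU : LipBackground EA W κ CU)
    (h5on : ∀ g ∈ W, ∀ U ∈ S, ∀ X : C.Dom, |EA g (C.transport U) X - EB g U X| ≤ C₅ * θ ^ C.scale X * Real.exp (-(κ * C.d X)))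
    {gA gB : ℕ → ℝ} (hgA : gA ∈ W) (hgB : gB ∈ W)
    {UA : C.BgA} {UB : C.BgB} (hUB : UB ∈ S) {δ : ℝ} (hδ : C.gauge UA (C.transport UB) ≤ δ)
    (X : C.Dom) (hCU : 0 ≤ CU gA (C.scale X)) :
    |EA gA UA X - EB gB UB X| ≤
      (CU gA (C.scale X) * δ
        + (∑ i ∈ Finset.range (C.scale X), Λ (C.scale X) i * |gA i - gB i|)
        + C₅ * θ ^ C.scale X) * Real.exp (-(κ * C.d X)) :=
  u3_threeBrackets_at h9 hU hgA hgB hδ X hCU (h5on gB hgB UB hUB X)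

/-- [folklore] **… and `T4OutputRate.NE5` is exactly the case `S = univ`.** -/
theorem ne5_iff_on_univ {W : Set (ℕ → ℝ)} {EA : Functional C C.BgA} {EB : Functional C C.BgB} {κ θ C₅ : ℝ} :
    NE5 EA EB W κ θ C₅ ↔
      ∀ g ∈ W, ∀ U ∈ (Set.univ : Set C.BgB), ∀ X : C.Dom,
        |EA g (C.transport U) X - EB g U X| ≤ C₅ * θ ^ C.scale X * Real.exp (-(κ * C.d X)) := by
  simp only [NE5, Set.mem_univ, true_implies]

/-! ## §6 Bookkeeping for the driven ALTERNATIVE (ii): node U3 on the driven pair, and the typed NE5 one triangle inequality away -/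

/-- [folklore] **NODE U3 ON THE DRIVEN PAIR, NO ARGUMENT BRACKET** (driven alternative (ii), not of record after R58).  If the η-rate is
supplied for the DRIVEN PAIR — run A's term at its own driven background `uA v` against run B's at `uB v`, same driving datum `v` — then node
U3's bound at `(uA v, uB v)` needs only the coupling bracket (NE9): no `LipBackground`, no `BackgroundsClose`, no transport. -/
theorem drivenPair_twoBrackets {Vd : Type} {W : Set (ℕ → ℝ)} {EA : Functional C C.BgA} {EB : Functional C C.BgB}
    {κ θ C₅ : ℝ} {Λ : ℕ → ℕ → ℝ} (uA : Vd → C.BgA) (uB : Vd → C.BgB) (h9 : NE9 EA W κ Λ)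
    (hpair : ∀ g ∈ W, ∀ (v : Vd) (X : C.Dom), |EA g (uA v) X - EB g (uB v) X| ≤ C₅ * θ ^ C.scale X * Real.exp (-(κ * C.d X)))
    {gA gB : ℕ → ℝ} (hgA : gA ∈ W) (hgB : gB ∈ W) (v : Vd) (X : C.Dom) :
    |EA gA (uA v) X - EB gB (uB v) X| ≤
      ((∑ i ∈ Finset.range (C.scale X), Λ (C.scale X) i * |gA i - gB i|) + C₅ * θ ^ C.scale X) * Real.exp (-(κ * C.d X)) := by
  have h2 : |EA gA (uA v) X - EA gB (uA v) X| ≤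
      Real.exp (-(κ * C.d X)) * ∑ i ∈ Finset.range (C.scale X), Λ (C.scale X) i * |gA i - gB i| := h9 gA hgA gB hgB (uA v) X
  have h3 := hpair gB hgB v X
  have t := abs_sub_le (EA gA (uA v) X) (EA gB (uA v) X) (EB gB (uB v) X)
  have eq : ((∑ i ∈ Finset.range (C.scale X), Λ (C.scale X) i * |gA i - gB i|) + C₅ * θ ^ C.scale X) * Real.exp (-(κ * C.d X))
      = Real.exp (-(κ * C.d X)) * (∑ i ∈ Finset.range (C.scale X), Λ (C.scale X) i * |gA i - gB i|)
        + C₅ * θ ^ C.scale X * Real.exp (-(κ * C.d X)) := by ring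
  rw [eq]
  linarith

/-- [folklore] **THE TYPED NE5 INEQUALITY AT A DRIVEN BACKGROUND FROM THE DRIVEN-PAIR RATE** — one triangle inequality: the driven-pair
rate + Lipschitz-in-U on run A (`LipBackground`) + `δ`-closeness of `uA v` to `transport (uB v)` (`BackgroundsClose`, node U1b) give
`|EA g (transport (uB v)) X − EB g (uB v) X| ≤ (CU g j·δ + C₅·θ^j)·e^{−κ d_j(X)}` — `T4OutputRate.NE5`'s inequality on the driven image
with the argument bracket ADDED (the reverse of `u3_threeBrackets`' bookkeeping: the two transports of record, block averaging (cell
convention (C3)) and same-datum pairing, are this inequality apart). -/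
theorem ne5At_transport_of_drivenPairRate {Vd : Type} {W : Set (ℕ → ℝ)} {EA : Functional C C.BgA} {EB : Functional C C.BgB}
    {κ θ C₅ δ : ℝ} {CU : (ℕ → ℝ) → ℕ → ℝ} (uA : Vd → C.BgA) (uB : Vd → C.BgB) (hU : LipBackground EA W κ CU)
    (hclose : BackgroundsClose uA uB δ)
    (hpair : ∀ g ∈ W, ∀ (v : Vd) (X : C.Dom), |EA g (uA v) X - EB g (uB v) X| ≤ C₅ * θ ^ C.scale X * Real.exp (-(κ * C.d X)))
    {g : ℕ → ℝ} (hg : g ∈ W) (v : Vd) (X : C.Dom) (hCU : 0 ≤ CU g (C.scale X)) :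
    |EA g (C.transport (uB v)) X - EB g (uB v) X| ≤
      (CU g (C.scale X) * δ + C₅ * θ ^ C.scale X) * Real.exp (-(κ * C.d X)) := by
  have he : 0 < Real.exp (-(κ * C.d X)) := Real.exp_pos _
  have h1 : |EA g (uA v) X - EA g (C.transport (uB v)) X| ≤ CU g (C.scale X) * Real.exp (-(κ * C.d X)) * δ :=
    (hU g hg (uA v) (C.transport (uB v)) X).trans (mul_le_mul_of_nonneg_left (hclose v) (mul_nonneg hCU he.le))
  have h3 := hpair g hg v X
  have t := abs_sub_le (EA g (C.transport (uB v)) X) (EA g (uA v) X) (EB g (uB v) X)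
  rw [abs_sub_comm] at h1
  have eq : (CU g (C.scale X) * δ + C₅ * θ ^ C.scale X) * Real.exp (-(κ * C.d X))
      = CU g (C.scale X) * Real.exp (-(κ * C.d X)) * δ + C₅ * θ ^ C.scale X * Real.exp (-(κ * C.d X)) := by ring
  rw [eq]
  linarith

end Summit.QuantumFields.BalabanUV.T4Continuum.OutputRateDrivingSlices

end
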